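import Mathlib
import HarnessLib
import Summits.Ventures.LatticeQCDFlow.Scaling.AutoregressiveGaugePlaquetteReads
import Summits.Ventures.LatticeQCDFlow.Scaling.AutoregressiveGaugeCornerMoves
import Summits.Ventures.LatticeQCDFlow.Scaling.U1DominoMeanPositive
import Summits.Ventures.LatticeQCDFlow.Scaling.TorusPlaquetteGeometry

/-!
# LatticeQCDFlow / Scaling — `U(1)` in ANY dimension: REACH THROUGH THE INTEGRATED BLOCK — with the shared
# link of two adjacent plaquettes integrated, the closing link reads links it shares no plaquette with

HONEST FRAMING: exact (Metropolis-corrected) sampling algorithms for lattice gauge theory;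
figures of merit are autocorrelation/cost numbers at stated couplings and volumes; no
continuum-physics claim.

Venture `LatticeQCDFlow` (cell pub-lqcd), topic `Scaling`, FANOUT row 30 (lean-1, GEN-18) — OUR WORK on
THEORY-2.md §4 row C5, gauge case: the any-dimension form of the two-dimensional domino theorems
(`Scaling/AutoregressiveGaugeDominoReads*`, explicit convolution-power law there; here Ginibre's inequality via
`Scaling/U1DominoMeanPositive`).  Torus `(ℤ/L)^d`, `G = U(1)`, Wilson weight `F = e^{−βS_W}`, `β > 0`, axes
`k < l`; the DOMINO at `x` = plaquettes `(x; k,l)`, `(x+e_k; k,l)` sharing `ℓ = (x+e_k, l)`; boundary links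
`e₁ = (x,k)` (closing), `e₃ = (x+e_l,k)`, `e₄ = (x,l)`, `f₁ = (x+e_k,k)`, `f₂ = (x+2e_k,l)`, `f₃ = (x+e_k+e_l,k)`;
`s` = all other links (so `ℓ ∈ s`); `N = A_s F`, `M = A_{insert e₁ s} F`, `R = N/M`.

* §1 **`wilson_u1_dominoMarginal_reads_closingLink_dir`** — THE ENGINE (`L ≥ 2`): `N` is not blind to
  `e₁` (else the domino holonomy would be Haar under the Wilson weight: `∫ Re(hol hol') e^{−βS_W} = 0`,
  against `wilson_u1_integral_re_domino_pos`).
* §2 **`wilson_u1_closingLink_reads_each_dominoLink`** (`L ≥ 3`) — `R` reads EACH of `e₃, e₄, f₁, f₂, f₃`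
  (corner moves of `Scaling/AutoregressiveGaugeCornerMoves` at `x`, `x+e_l`, `x+e_k`, `x+2e_k`, `x+2e_k+e_l`):
  in particular the NEXT COLLINEAR LINK `f₁` (sharing the site `x+e_k` but no plaquette with `e₁`) and `f₂`,
  `f₃`, with which `e₁` shares neither a plaquette nor a site.

READING (value-free, C5): for `U(1)` lattice gauge theory in every dimension (`d = 4` included), at every
`β > 0` and volume, the exact autoregressive context of a link is NOT confined to its plaquette
neighbourhood: integrating the link between two plaquettes makes the closing link of one read every boundary
link of the pair.  NOT CLAIMED: non-abelian groups (needs `⟨W_{2×1}⟩ > 0` on the torus); longer chains; any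
number of ours.  Elementary over the parents; no `def`; nothing is cited as a fact; no `sorry`.
-/

noncomputable section

namespace Summit.Ventures.LatticeQCDFlow.Theory2.Autoregressive

open MeasureTheory Function Set
open Literature.MathematicalPhysics.QuantumFieldTheory Literature.MathematicalPhysics.QuantumLattice
open Summit.Ventures.LatticeQCDFlow.Exactness
open Summit.Ventures.LatticeQCDFlow.Theory2.Lattice.TwoDim (measurable_circle_re abs_circle_re_le_one)
open Summit.Ventures.LatticeQCDFlow.Theory2.Lattice.TorusGeom (single_inj add_single_ne_self
  add_single_add_single_ne_self)

variable {d L : ℕ} [NeZero L]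

/-! ## §1 The engine in any dimension -/

/-- **THE DOMINO MARGINAL READS THE CLOSING LINK** (`U(1)`, any `d`, `L ≥ 2`, `β > 0`, `k < l`): with `s` the
links off the boundary of the domino at `x` (the shared link `(x+e_k, l)` IS in `s`), the partial Haar marginal
`N = A_s e^{−βS_W}` is not blind to `e₁ = (x, k)`. [ours] -/
theorem wilson_u1_dominoMarginal_reads_closingLink_dir (hL : 2 ≤ L) {β : ℝ} (hβ : 0 < β) (x : Site d L)
    {k l : Fin d} (hkl : k < l) :
    ∃ (U : GaugeConfig d L Circle) (v : Circle),
      coordAvg (haarProbability Circle)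
          (Finset.univ \ {(x, k), (x.shift l, k), (x, l), (x.shift k, k), ((x.shift k).shift k, l),
            ((x.shift k).shift l, k)})
          (fun V : GaugeConfig d L Circle => Real.exp (-β * wilsonAction u1Rep V)) (update U (x, k) v) ≠
      coordAvg (haarProbability Circle)
          (Finset.univ \ {(x, k), (x.shift l, k), (x, l), (x.shift k, k), ((x.shift k).shift k, l),
            ((x.shift k).shift l, k)})
          (fun V : GaugeConfig d L Circle => Real.exp (-β * wilsonAction u1Rep V)) U := by
  classical
  have hkl' : k ≠ l := ne_of_lt hkl
  set μ := haarProbability Circle with hμ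
  set s : Finset (Edge d L) := Finset.univ \ {(x, k), (x.shift l, k), (x, l), (x.shift k, k),
    ((x.shift k).shift k, l), ((x.shift k).shift l, k)} with hs
  set F : GaugeConfig d L Circle → ℝ := fun V => Real.exp (-β * wilsonAction u1Rep V) with hF
  set N := coordAvg μ s F with hN
  by_contra hcon
  push Not at hcon
  obtain ⟨hFm, hFb, hFlo⟩ := wilsonWeight_u1_props (d := d) (L := L) hβ.le
  have hF1 : ∀ V, F V ≤ 1 := fun V => (le_abs_self _).trans (hFb V)
  have hNb : ∀ U, Real.exp (-(2 * β * Fintype.card (Plaquette d L))) ≤ N U ∧ N U ≤ 1 := fun U =>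
    coordAvg_mem_Icc μ s hFm hFlo hF1 U
  have hNpos : ∀ U, 0 < N U := fun U => lt_of_lt_of_le (Real.exp_pos _) (hNb U).1
  have hNabs : ∀ U, |N U| ≤ 1 := fun U => by rw [abs_of_pos (hNpos U)]; exact (hNb U).2
  have hpos := wilson_u1_integral_re_domino_pos (d := d) hL hβ x hkl
  -- `Re(hol hol')` is blind to `s`: a word in the six boundary links
  have hn1 : ((x, k) : Edge d L) ∉ s := by simp [hs]
  have hn3 : ((x.shift l, k) : Edge d L) ∉ s := by simp [hs]
  have hn4 : ((x, l) : Edge d L) ∉ s := by simp [hs]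
  have hm1 : ((x.shift k, k) : Edge d L) ∉ s := by simp [hs]
  have hm2 : (((x.shift k).shift k, l) : Edge d L) ∉ s := by simp [hs]
  have hm3 : (((x.shift k).shift l, k) : Edge d L) ∉ s := by simp [hs]
  have hhol_s : ∀ U V : GaugeConfig d L Circle,
      plaquetteHolonomy (s.piecewise V U) x k l * plaquetteHolonomy (s.piecewise V U) (x.shift k) k l =
        plaquetteHolonomy U x k l * plaquetteHolonomy U (x.shift k) k l := by
    intro U V
    rw [plaquetteHolonomy_mul_shift_dir, plaquetteHolonomy_mul_shift_dir]
    simp only [Finset.piecewise_eq_of_notMem _ _ _ hn1, Finset.piecewise_eq_of_notMem _ _ _ hn3,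
      Finset.piecewise_eq_of_notMem _ _ _ hn4, Finset.piecewise_eq_of_notMem _ _ _ hm1,
      Finset.piecewise_eq_of_notMem _ _ _ hm2, Finset.piecewise_eq_of_notMem _ _ _ hm3]
  have hhm : Measurable fun U : GaugeConfig d L Circle =>
      plaquetteHolonomy U x k l * plaquetteHolonomy U (x.shift k) k l :=
    (measurable_plaquetteHolonomy x k l).mul (measurable_plaquetteHolonomy (x.shift k) k l)
  have h1 : ∫ U, ((plaquetteHolonomy U x k l * plaquetteHolonomy U (x.shift k) k l : Circle) : ℂ).re * F U
        ∂Measure.pi (fun _ : Edge d L => μ) =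
      ∫ U, ((plaquetteHolonomy U x k l * plaquetteHolonomy U (x.shift k) k l : Circle) : ℂ).re * N U
        ∂Measure.pi (fun _ : Edge d L => μ) :=
    integral_mul_coordAvg_eq μ s
      (Φ := fun U => ((plaquetteHolonomy U x k l * plaquetteHolonomy U (x.shift k) k l : Circle) : ℂ).re)
      hFm ⟨1, hFb⟩ (measurable_circle_re.comp hhm) ⟨1, fun U => abs_circle_re_le_one _⟩
      (fun U V => by simp only [hhol_s])
  -- redraw `e₁`: the domino holonomy becomes Haar, and `∫ Re dHaar = 0`
  have hre0 : ∫ u : Circle, ((u : Circle) : ℂ).re ∂μ = 0 := by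
    have h := integral_mul_left_eq_self (μ := μ) (fun u : Circle => ((u : Circle) : ℂ).re) (-1 : Circle)
    simp only [neg_one_mul, Circle.coe_neg, Complex.neg_re, integral_neg] at h
    linarith
  have h2 : ∫ U, ((plaquetteHolonomy U x k l * plaquetteHolonomy U (x.shift k) k l : Circle) : ℂ).re * N U
      ∂Measure.pi (fun _ : Edge d L => μ) = 0 := by
    rw [hμ, integral_comp_dominoHolonomy_mul_dir hL x hkl' measurable_circle_re abs_circle_re_le_one
      (measurable_coordAvg _ s hFm) hNabs hcon, hre0, zero_mul]
  exact (ne_of_gt hpos) (h1.trans h2)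


/-! ## §2 The closing link reads every boundary link of the domino -/

/-- **THE CLOSING LINK READS EACH OF THE FIVE OTHER BOUNDARY LINKS OF THE DOMINO — ANY DIMENSION** (`U(1)`,
Wilson action, `L ≥ 3`, `β > 0`, `k < l`): for EACH boundary link `b ≠ e₁` of the domino at `x` —
`(x+e_l, k)`, `(x, l)`, `(x+e_k, k)`, `(x+2e_k, l)`, `(x+e_k+e_l, k)` — there are two configurations differing
ONLY at `b` on which the exact conditional `N/M` of `U_{e₁}` differs. [ours] -/
theorem wilson_u1_closingLink_reads_each_dominoLink (hL3 : 3 ≤ L) {β : ℝ} (hβ : 0 < β) (x : Site d L)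
    {k l : Fin d} (hkl : k < l) (b : Edge d L)
    (hb : b ∈ ({(x.shift l, k), (x, l), (x.shift k, k), ((x.shift k).shift k, l), ((x.shift k).shift l, k)} :
      Finset (Edge d L))) :
    ∃ U U' : GaugeConfig d L Circle,
      (∀ e : Edge d L, e ≠ b → U e = U' e) ∧
      coordAvg (haarProbability Circle)
          (Finset.univ \ {(x, k), (x.shift l, k), (x, l), (x.shift k, k), ((x.shift k).shift k, l),
            ((x.shift k).shift l, k)})
          (fun V : GaugeConfig d L Circle => Real.exp (-β * wilsonAction u1Rep V)) U /
        coordAvg (haarProbability Circle)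
          (insert (x, k)
            (Finset.univ \ {(x, k), (x.shift l, k), (x, l), (x.shift k, k), ((x.shift k).shift k, l),
              ((x.shift k).shift l, k)}))
          (fun V : GaugeConfig d L Circle => Real.exp (-β * wilsonAction u1Rep V)) U ≠
      coordAvg (haarProbability Circle)
          (Finset.univ \ {(x, k), (x.shift l, k), (x, l), (x.shift k, k), ((x.shift k).shift k, l),
            ((x.shift k).shift l, k)})
          (fun V : GaugeConfig d L Circle => Real.exp (-β * wilsonAction u1Rep V)) U' /
        coordAvg (haarProbability Circle)
          (insert (x, k)
            (Finset.univ \ {(x, k), (x.shift l, k), (x, l), (x.shift k, k), ((x.shift k).shift k, l),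
              ((x.shift k).shift l, k)}))
          (fun V : GaugeConfig d L Circle => Real.exp (-β * wilsonAction u1Rep V)) U' := by
  have hL : 2 ≤ L := le_trans (by norm_num) hL3
  classical
  have hkl' : k ≠ l := ne_of_lt hkl
  -- names
  set μ := haarProbability Circle with hμ
  set e₁ : Edge d L := (x, k) with he₁
  set e₃ : Edge d L := (x.shift l, k) with he₃
  set e₄ : Edge d L := (x, l) with he₄
  set f₁ : Edge d L := (x.shift k, k) with hf₁
  set f₂ : Edge d L := ((x.shift k).shift k, l) with hf₂
  set f₃ : Edge d L := ((x.shift k).shift l, k) with hf₃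
  set s : Finset (Edge d L) := Finset.univ \ {e₁, e₃, e₄, f₁, f₂, f₃} with hs
  set F : GaugeConfig d L Circle → ℝ := fun V => Real.exp (-β * wilsonAction u1Rep V) with hF
  set N := coordAvg μ s F with hN
  set M := coordAvg μ (insert e₁ s) F with hM
  -- geometry, `L ≥ 2`
  have hek : ∀ z : Site d L, z.shift k ≠ z := fun z => add_single_ne_self hL z k
  have hel : ∀ z : Site d L, z.shift l ≠ z := fun z => add_single_ne_self hL z l
  have hkn : ∀ z : Site d L, z.shift k ≠ z.shift l := fun z h => hkl' (single_inj hL (add_left_cancel h))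
  have hcomm : ∀ z : Site d L, (z.shift k).shift l = (z.shift l).shift k := fun z => by
    simp only [Site.shift]; exact add_right_comm _ _ _
  have hSkl : ∀ z : Site d L, (z.shift k).shift l ≠ z := by
    intro z h
    apply single_add_single_ne_zero_of_ne hL hkl'
    have h' : z + (Pi.single k 1 + Pi.single l 1) = z + 0 := by
      rw [add_zero, ← add_assoc]; exact h
    exact add_left_cancel h'
  have hmem_s : ∀ e : Edge d L, e ∈ s ↔ e ≠ e₁ ∧ e ≠ e₃ ∧ e ≠ e₄ ∧ e ≠ f₁ ∧ e ≠ f₂ ∧ e ≠ f₃ := by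
    intro e; simp [hs]
  have hinc : ∀ (e : Edge d L) (y : Site d L), e.1 ≠ y → e.1.shift e.2 ≠ y →
      ¬ (e.1 = y ∨ e.1.shift e.2 = y) := fun e y h1 h2 h => h.elim h1 h2
  -- weight facts
  obtain ⟨hFm, hFb, hFlo⟩ := wilsonWeight_u1_props (d := d) (L := L) hβ.le
  have hFgi : IsGaugeInvariant F := isGaugeInvariant_wilsonWeightFun u1Rep β
  have hF1 : ∀ V, F V ≤ 1 := fun V => (le_abs_self _).trans (hFb V)
  have hMb : ∀ U, Real.exp (-(2 * β * Fintype.card (Plaquette d L))) ≤ M U ∧ M U ≤ 1 := fun U =>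
    coordAvg_mem_Icc μ (insert e₁ s) hFm hFlo hF1 U
  have hMpos : ∀ U, 0 < M U := fun U => lt_of_lt_of_le (Real.exp_pos _) (hMb U).1
  have hMe₁ : ∀ (U : GaugeConfig d L Circle) (v : Circle), M (update U e₁ v) = M U := by
    intro U v
    refine coordAvg_congr_off (insert e₁ s) F fun e he => ?_
    have : e ≠ e₁ := fun h => he (h ▸ Finset.mem_insert_self e₁ s)
    exact update_of_ne this _ _
  -- Step 0: `R = N/M` is not blind to `e₁` (the engine)
  have hR1 : ¬ ∀ (U : GaugeConfig d L Circle) (v : Circle),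
      N (update U e₁ v) / M (update U e₁ v) = N U / M U := by
    intro hb
    obtain ⟨U, v, hUv⟩ := wilson_u1_dominoMarginal_reads_closingLink_dir (d := d) hL hβ x hkl
    apply hUv
    have h := hb U v
    rw [hMe₁] at h
    exact (div_left_inj' (hMpos U).ne').1 h
  -- Corner A: `x + e_k` (`e₁` arrives, `f₁` leaves): blind `e₁` ↔ blind `f₁`
  have hstarA : ∀ e : Edge d L, e.1 = x.shift k ∨ e.1.shift e.2 = x.shift k → e ≠ e₁ → e ≠ f₁ → e ∈ s := by
    intro e he hn1 hn2
    rw [hmem_s]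
    refine ⟨hn1, fun h => ?_, fun h => ?_, hn2, fun h => ?_, fun h => ?_⟩ <;> subst h
    · exact hinc _ _ (show x.shift l ≠ x.shift k from (hkn x).symm)
        (show (x.shift l).shift k ≠ x.shift k by rw [← hcomm]; exact hel (x.shift k)) he
    · exact hinc _ _ (show x ≠ x.shift k from (hek x).symm) (show x.shift l ≠ x.shift k from (hkn x).symm) he
    · exact hinc _ _ (show (x.shift k).shift k ≠ x.shift k from hek (x.shift k))
        (show ((x.shift k).shift k).shift l ≠ x.shift k from hSkl (x.shift k)) he
    · exact hinc _ _ (show (x.shift k).shift l ≠ x.shift k from hel (x.shift k))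
        (show ((x.shift k).shift l).shift k ≠ x.shift k by rw [← hcomm]; exact hSkl (x.shift k)) he
  have hCA := arConditional_blind_iff_of_cornerThrough (G := Circle) (s := s) hFgi e₁ (y := x.shift k)
    (ℓ₁ := e₁) (ℓ₂ := f₁) (fun h => (hek x).symm (congrArg Prod.fst h)) rfl (hek x).symm rfl
    (hek (x.shift k)) hstarA
  have hnf1 : ¬ _ := fun h => hR1 (hCA.2 h)
  -- not blind ⇒ two configurations differing only at `b`
  have key : ∀ b' : Edge d L, (¬ ∀ (U : GaugeConfig d L Circle) (v : Circle),
      N (update U b' v) / M (update U b' v) = N U / M U) →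
      ∃ U U' : GaugeConfig d L Circle, (∀ e : Edge d L, e ≠ b' → U e = U' e) ∧ N U / M U ≠ N U' / M U' := by
    intro b' hb'
    push Not at hb'
    obtain ⟨U, v, hUv⟩ := hb'
    exact ⟨U, update U b' v, fun e he => (update_of_ne he _ _).symm, fun h => hUv h.symm⟩
  -- geometry, `L ≥ 3`
  have hSkk : ∀ z : Site d L, (z.shift k).shift k ≠ z := fun z => add_single_add_single_ne_self hL3 z k k
  have hSkkl : ∀ z : Site d L, ((z.shift k).shift k).shift l ≠ z := by
    haveI : Fact (1 < L) := ⟨hL⟩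
    intro z h
    have h' := congrFun h l
    simp [Site.shift, Pi.single_eq_of_ne (Ne.symm hkl')] at h'
  have hSkk_l : ∀ z : Site d L, (z.shift k).shift k ≠ z.shift l := by
    haveI : Fact (1 < L) := ⟨hL⟩
    intro z h
    have h' := congrFun h l
    simp [Site.shift, Pi.single_eq_of_ne (Ne.symm hkl')] at h'
  have yE1 : ((x.shift k).shift k).shift l = ((x.shift k).shift l).shift k := hcomm (x.shift k)
  have yE2 : ((x.shift k).shift k).shift l = ((x.shift l).shift k).shift k := by rw [yE1, hcomm x]
  -- Corner B: `x` (`e₁`, `e₄` leave): blind `e₁` ↔ blind `e₄`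
  have hstarB : ∀ e : Edge d L, e.1 = x ∨ e.1.shift e.2 = x → e ≠ e₁ → e ≠ e₄ → e ∈ s := by
    intro e he hn1 hn2
    rw [hmem_s]
    refine ⟨hn1, fun h => ?_, hn2, fun h => ?_, fun h => ?_, fun h => ?_⟩ <;> subst h
    · exact hinc _ _ (show x.shift l ≠ x from hel x)
        (show (x.shift l).shift k ≠ x by rw [← hcomm]; exact hSkl x) he
    · exact hinc _ _ (show x.shift k ≠ x from hek x) (show (x.shift k).shift k ≠ x from hSkk x) he
    · exact hinc _ _ (show (x.shift k).shift k ≠ x from hSkk x)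
        (show ((x.shift k).shift k).shift l ≠ x from hSkkl x) he
    · exact hinc _ _ (show (x.shift k).shift l ≠ x from hSkl x)
        (show ((x.shift k).shift l).shift k ≠ x by rw [← yE1]; exact hSkkl x) he
  have hCB := arConditional_blind_iff_of_cornerOut (G := Circle) (s := s) hFgi e₁ (y := x)
    (ℓ₁ := e₁) (ℓ₂ := e₄) (fun h => hkl' (congrArg Prod.snd h)) rfl (hek x) rfl (hel x) hstarB
  -- Corner C: `x + e_l` (`e₄` arrives, `e₃` leaves): blind `e₄` ↔ blind `e₃`
  have hstarC : ∀ e : Edge d L, e.1 = x.shift l ∨ e.1.shift e.2 = x.shift l → e ≠ e₄ → e ≠ e₃ → e ∈ s := by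
    intro e he hn1 hn2
    rw [hmem_s]
    refine ⟨fun h => ?_, hn2, hn1, fun h => ?_, fun h => ?_, fun h => ?_⟩ <;> subst h
    · exact hinc _ _ (show x ≠ x.shift l from (hel x).symm) (show x.shift k ≠ x.shift l from hkn x) he
    · exact hinc _ _ (show x.shift k ≠ x.shift l from hkn x)
        (show (x.shift k).shift k ≠ x.shift l from hSkk_l x) he
    · exact hinc _ _ (show (x.shift k).shift k ≠ x.shift l from hSkk_l x)
        (show ((x.shift k).shift k).shift l ≠ x.shift l from fun h =>
          hSkk x (add_right_cancel (h : ((x.shift k).shift k) + Pi.single l 1 = x + Pi.single l 1))) he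
    · exact hinc _ _ (show (x.shift k).shift l ≠ x.shift l from fun h =>
          hek x (add_right_cancel (h : (x.shift k) + Pi.single l 1 = x + Pi.single l 1)))
        (show ((x.shift k).shift l).shift k ≠ x.shift l by
          rw [hcomm x]; exact hSkk (x.shift l)) he
  have hCC := arConditional_blind_iff_of_cornerThrough (G := Circle) (s := s) hFgi e₁ (y := x.shift l)
    (ℓ₁ := e₄) (ℓ₂ := e₃) (fun h => (hel x).symm (congrArg Prod.fst h)) rfl (hel x).symm rfl
    (hek (x.shift l)) hstarC
  -- Corner D: `x + 2e_k` (`f₁` arrives, `f₂` leaves): blind `f₁` ↔ blind `f₂`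
  have hstarD : ∀ e : Edge d L, e.1 = (x.shift k).shift k ∨ e.1.shift e.2 = (x.shift k).shift k →
      e ≠ f₁ → e ≠ f₂ → e ∈ s := by
    intro e he hn1 hn2
    rw [hmem_s]
    refine ⟨fun h => ?_, fun h => ?_, fun h => ?_, hn1, hn2, fun h => ?_⟩ <;> subst h
    · exact hinc _ _ (show x ≠ (x.shift k).shift k from (hSkk x).symm)
        (show x.shift k ≠ (x.shift k).shift k from (hek (x.shift k)).symm) he
    · exact hinc _ _ (show x.shift l ≠ (x.shift k).shift k from (hSkk_l x).symm)
        (show (x.shift l).shift k ≠ (x.shift k).shift k by rw [← hcomm]; exact (hkn (x.shift k)).symm) he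
    · exact hinc _ _ (show x ≠ (x.shift k).shift k from (hSkk x).symm)
        (show x.shift l ≠ (x.shift k).shift k from (hSkk_l x).symm) he
    · exact hinc _ _ (show (x.shift k).shift l ≠ (x.shift k).shift k from (hkn (x.shift k)).symm)
        (show ((x.shift k).shift l).shift k ≠ (x.shift k).shift k by
          rw [← yE1]; exact hel ((x.shift k).shift k)) he
  have hCD := arConditional_blind_iff_of_cornerThrough (G := Circle) (s := s) hFgi e₁
    (y := (x.shift k).shift k) (ℓ₁ := f₁) (ℓ₂ := f₂) (fun h => hkl' (congrArg Prod.snd h)) rfl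
    (hek (x.shift k)).symm rfl (hel ((x.shift k).shift k)) hstarD
  -- Corner E: `x + 2e_k + e_l` (`f₂`, `f₃` both arrive): blind `f₂` ↔ blind `f₃`
  have hstarE : ∀ e : Edge d L, e.1 = ((x.shift k).shift k).shift l ∨ e.1.shift e.2 = ((x.shift k).shift k).shift l →
      e ≠ f₂ → e ≠ f₃ → e ∈ s := by
    intro e he hn1 hn2
    rw [hmem_s]
    refine ⟨fun h => ?_, fun h => ?_, fun h => ?_, fun h => ?_, hn1, hn2⟩ <;> subst h
    · exact hinc _ _ (show x ≠ ((x.shift k).shift k).shift l from (hSkkl x).symm)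
        (show x.shift k ≠ ((x.shift k).shift k).shift l from (hSkl (x.shift k)).symm) he
    · exact hinc _ _ (show x.shift l ≠ ((x.shift k).shift k).shift l by rw [yE2]; exact (hSkk (x.shift l)).symm)
        (show (x.shift l).shift k ≠ ((x.shift k).shift k).shift l by
          rw [yE1, ← hcomm x]; exact (hek ((x.shift k).shift l)).symm) he
    · exact hinc _ _ (show x ≠ ((x.shift k).shift k).shift l from (hSkkl x).symm)
        (show x.shift l ≠ ((x.shift k).shift k).shift l by rw [yE2]; exact (hSkk (x.shift l)).symm) he
    · exact hinc _ _ (show x.shift k ≠ ((x.shift k).shift k).shift l from (hSkl (x.shift k)).symm)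
        (show (x.shift k).shift k ≠ ((x.shift k).shift k).shift l from (hel _).symm) he
  have hCE := arConditional_blind_iff_of_cornerIn (G := Circle) (s := s) hFgi e₁
    (y := ((x.shift k).shift k).shift l) (ℓ₁ := f₂) (ℓ₂ := f₃)
    (fun h => (hkn (x.shift k)) (congrArg Prod.fst h)) rfl (hel ((x.shift k).shift k)).symm
    (by rw [yE1]) (by rw [yE1]; exact (hek ((x.shift k).shift l)).symm) hstarE
  -- none of the five is blind
  have hne4 : ¬ _ := fun h => hR1 (hCB.2 h)
  have hne3 : ¬ _ := fun h => hne4 (hCC.2 h)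
  have hnf2 : ¬ _ := fun h => hnf1 (hCD.2 h)
  have hnf3 : ¬ _ := fun h => hnf2 (hCE.2 h)
  simp only [Finset.mem_insert, Finset.mem_singleton] at hb
  rcases hb with rfl | rfl | rfl | rfl | rfl
  · exact key _ hne3
  · exact key _ hne4
  · exact key _ hnf1
  · exact key _ hnf2
  · exact key _ hnf3

end Summit.Ventures.LatticeQCDFlow.Theory2.Autoregressive

end
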